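import Summits.CriticalPhenomena.SAWScalingLimit.Theorems.SAWLeftRightFKGFKGToTraversalBoundOutlineAbab
import HarnessLib

/-!
# Obstacle contacts along the wall-follower tour: the two endpoint pockets (witness unit U5d, part 1)

Crux `SAWLeftRightFKG.FKGToTraversalBound` (stmt-CriticalPhenomena-1878), line `slit-necklace`, lead
prover-line-stmt-CriticalPhenomena-1878-c5-0; witness unit U5d (no bad triple of obstacle contacts along the tour),
on top of the vocabulary `…SlitNecklaceOutline` (`ODir`, `IsBEdge`, `bsite`, `bcontact`), `…OutlineFaces`
(`cornerFace`, `sepEdge_cornerFace`) and the winding-number toolkit re-exported by `…OutlineAbab`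
(`abab_walkWinding_ne_of_sepEdge_mem`).

Setting: `A ⊆ ℤ²` a `4`-connected finite site set, `r` a lattice PATH avoiding `A` (the obstacle), `f ∈ A` an
outline site with two contacts on `r`.  This file refutes the two ENDPOINT-WRAP configurations of unit U5c in the
presence of a third contact beyond the wrap:

* `triple_pocket_v` — the pocket `r[m .. L]` closed by the lattice edge `r_L → r_m` (`r_L = r_m + d`,
  `r_m = f + d.ccw`, `r_{m-1} = r_m + d.ccw`), together with an `A`-site `a` adjacent to some `r_{m'}`, `m' < m`;
* `triple_pocket_u` — the mirror pocket `r[0 .. n]` closed by `r_n → r_0` (`r_0 = r_n + d.ccw`, `r_n = f + d`,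
  `r_{n+1} = r_n + d`), together with an `A`-site adjacent to some `r_{m'}`, `m' > n`.

Proof (discrete planar topology by the tree's combinatorial winding number `walkWinding`, no Jordan curve
theorem): the pocket is a closed lattice TRAIL, so it winds differently about the two faces of its closing edge
(`abab_walkWinding_ne_of_sepEdge_mem`); one of these faces is a face around `f`, the other a face around the
`r`-vertex just outside the pocket (`r_{m-1}`, resp. `r_{n+1}`); but `f` is joined to that vertex off the pocket —
through `A` to `a`, across the edge `a — r_{m'}`, and along `r` outside the pocket — so the two faces carry the same
winding number (`walkWinding_eq_of_mem_corners`, `walkWinding_eq_of_walk_closed`).  Also recorded: sub-paths of a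
lattice path by vertex indices (`triple_slice`), edges of a walk join consecutive vertices (`triple_mem_edges`), and
two corner-face incidences (`triple_cornerFace_back`, `triple_cornerFace_end_ahead`).

All statements folklore (Kesten, *Percolation theory for mathematicians* (1982), §2.2 for the winding-number
bookkeeping, already formalised in `PlanarDuality.lean` / `RandomClusterBoxDuality.lean` /
`SquareTilingConjugate.lean`); no literature fact is introduced; nothing restates the crux.
-/

noncomputable section

open Set
open Literature.Probability.LatticeModels Literature.Probability.Percolation
open Literature.Probability.LatticeModels.SquareTiling (corners mem_corners_iff walkWinding_eq_of_walk_closed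
  walkWinding_eq_of_mem_corners)

namespace Summit.CriticalPhenomena.SAWScalingLimit.Theorems.FKGToTraversalBound.SlitNecklace

/-! ### Faces around sites -/

/-- The start-corner face of the boundary edge `(x, d)` is a face around the site BEHIND `x`, i.e. around
`x - vec (ccw d)` (its four corners are `x`, `x + d`, `x - d.ccw`, `x + d - d.ccw`). [folklore] -/
theorem triple_cornerFace_back (x : Site 2) (d : ODir) : cornerFace (x, d) + 1 ∈ corners (x - d.ccw.vec) := by
  rw [mem_corners_iff]
  fin_cases d <;> simp [ODir.foff, ODir.vec, ODir.ccw]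

/-- The end-corner face of the boundary edge `(x, d)` is a face around the site AHEAD of `x`, i.e. around
`x + vec (ccw d)` (its four corners are `x`, `x + d`, `x + d.ccw`, `x + d + d.ccw`). [folklore] -/
theorem triple_cornerFace_end_ahead (x : Site 2) (d : ODir) :
    cornerFace (x, d) + d.ccw.vec + 1 ∈ corners (x + d.ccw.vec) := by
  rw [mem_corners_iff]
  fin_cases d <;> simp [ODir.foff, ODir.vec, ODir.ccw]

/-- **A face around a site off a closed walk reads the winding number at that site**: if `F + 1 ∈ corners q`
(the face with lower-left corner `F` has `q` as a corner) and `q ∉ p.support`, then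
`walkWinding p F = walkWinding p q`. [folklore] -/
theorem triple_walkWinding_face {a : Site 2} (p : (zdGraph 2).Walk a a) {q F : Site 2}
    (hq : q ∉ p.support) (hF : F + 1 ∈ corners q) : walkWinding p F = walkWinding p q := by
  have h1 := walkWinding_eq_of_mem_corners p hq hF
  have h2 := walkWinding_eq_of_mem_corners p hq (c := q + 1) (by rw [mem_corners_iff]; simp)
  rw [add_sub_cancel_right] at h1 h2
  rw [h1, ← h2]

/-! ### Sub-paths of a lattice path -/

/-- **An edge of a walk joins two consecutive vertices**: if `s(x, y)` is an edge of `p` then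
`{x, y} = {p_k, p_{k+1}}` for some `k < p.length`. [folklore] -/
theorem triple_mem_edges {a b : Site 2} (p : (zdGraph 2).Walk a b) {x y : Site 2} (h : s(x, y) ∈ p.edges) :
    ∃ k, k < p.length ∧ ((p.getVert k = x ∧ p.getVert (k + 1) = y) ∨
      (p.getVert k = y ∧ p.getVert (k + 1) = x)) := by
  induction p with
  | nil => simp at h
  | cons hadj q ih =>
    rw [SimpleGraph.Walk.edges_cons, List.mem_cons] at h
    rcases h with h | h
    · refine ⟨0, by simp, ?_⟩
      simp only [SimpleGraph.Walk.getVert_zero, zero_add, SimpleGraph.Walk.getVert_cons_succ]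
      rcases Sym2.eq_iff.1 h with ⟨rfl, rfl⟩ | ⟨rfl, rfl⟩
      · exact Or.inl ⟨rfl, rfl⟩
      · exact Or.inr ⟨rfl, rfl⟩
    · obtain ⟨k, hk, hk'⟩ := ih h
      refine ⟨k + 1, by simp; omega, ?_⟩
      simpa only [SimpleGraph.Walk.getVert_cons_succ] using hk'

/-- **Sub-path of a path between two vertex indices `i ≤ j`**: a path from `p_i` to `p_j` whose vertices are
the `p_k`, `i ≤ k ≤ j`, and whose edges are edges of `p`. [folklore] -/
theorem triple_slice {a b : Site 2} {p : (zdGraph 2).Walk a b} (hp : p.IsPath) {i j : ℕ} (hij : i ≤ j) :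
    ∃ q : (zdGraph 2).Walk (p.getVert i) (p.getVert j), q.IsPath ∧
      (∀ z ∈ q.support, ∃ k, i ≤ k ∧ k ≤ j ∧ z = p.getVert k) ∧ (∀ e ∈ q.edges, e ∈ p.edges) := by
  have hend : (p.drop i).getVert (j - i) = p.getVert j := by
    rw [SimpleGraph.Walk.drop_getVert]; congr 1; omega
  refine ⟨((p.drop i).take (j - i)).copy rfl hend, ?_, ?_, ?_⟩
  · simpa using (hp.drop i).take (j - i)
  · intro z hz
    rw [SimpleGraph.Walk.support_copy, SimpleGraph.Walk.mem_support_iff_exists_getVert] at hz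
    obtain ⟨n, hn, -⟩ := hz
    rw [SimpleGraph.Walk.take_getVert, SimpleGraph.Walk.drop_getVert] at hn
    exact ⟨i + min (j - i) n, by omega, by omega, hn.symm⟩
  · intro e he
    rw [SimpleGraph.Walk.edges_copy, SimpleGraph.Walk.edges_take, SimpleGraph.Walk.edges_drop] at he
    exact List.mem_of_mem_drop (List.mem_of_mem_take he)

/-! ### The pocket through the far endpoint `v = r_L` -/

/-- **Pocket through `v` (refutation of the wrap through the far endpoint in the presence of an earlier contact).**
`r` a lattice path avoiding the `4`-connected set `A`; `f ∈ A`; `r_m = f + d.ccw`, `r_L = f + d + d.ccw`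
(so the lattice edge `r_L — r_m` closes the pocket `r[m .. L]`, `L ≥ m + 3`), `r_{m-1} = r_m + d.ccw`; and an
`A`-site `a` adjacent to a vertex `r_{m'}` with `m' < m`.  Impossible: the pocket winds differently about the
block face (around `f`) and the face ahead (around `r_{m-1}`), yet `f ⟶_A a — r_{m'} ⟶_r r_{m-1}` avoids the
pocket. [folklore] -/
theorem triple_pocket_v : ∀ (A : Finset (Site 2)) {u v : Site 2} (r : (zdGraph 2).Walk u v) (f a : Site 2) (d : ODir) (m m' : ℕ), r.IsPath → (∀ z ∈ r.support, z ∉ A) → (∀ x ∈ A, ∀ y ∈ A, ∃ w : (zdGraph 2).Walk x y, ∀ z ∈ w.support, z ∈ A) → f ∈ A → a ∈ A → (zdGraph 2).Adj a (r.getVert m') → m' < m → m + 3 ≤ r.length → r.getVert m = f + d.ccw.vec → r.getVert r.length = f + d.vec + d.ccw.vec → r.getVert (m - 1) = r.getVert m + d.ccw.vec → False := by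
  intro A u v r f a d m m' hr hrA hA hf ha hadj hm'm hmL hm hL hm1
  have hinj : ∀ i j, i ≤ r.length → j ≤ r.length → r.getVert i = r.getVert j → i = j :=
    fun i j hi hj h => hr.getVert_injOn (by simpa using hi) (by simpa using hj) h
  -- the pocket: `r[m .. L]` closed by the lattice edge `r_L → r_m`
  obtain ⟨q, hqp, hqs, hqe⟩ := triple_slice hr (show m ≤ r.length by omega)
  have hvx : r.getVert r.length = r.getVert m + d.vec := by rw [hL, hm]; abel
  have hclose : (zdGraph 2).Adj (r.getVert r.length) (r.getVert m) := by
    rw [hvx]; exact (ODir.adj_add_vec _ _).symm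
  set Ψ : (zdGraph 2).Walk (r.getVert r.length) (r.getVert r.length) := SimpleGraph.Walk.cons hclose q with hΨ
  have hΨs : ∀ z ∈ Ψ.support, ∃ k, m ≤ k ∧ k ≤ r.length ∧ z = r.getVert k := by
    intro z hz
    rw [hΨ, SimpleGraph.Walk.support_cons, List.mem_cons] at hz
    rcases hz with rfl | hz
    · exact ⟨r.length, by omega, le_rfl, rfl⟩
    · exact hqs z hz
  have hoffA : ∀ z ∈ A, z ∉ Ψ.support := fun z hz hzΨ => by
    obtain ⟨k, -, -, rfl⟩ := hΨs z hzΨ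
    exact hrA _ (r.getVert_mem_support k) hz
  have hofflt : ∀ k, k < m → r.getVert k ∉ Ψ.support := fun k hk hkΨ => by
    obtain ⟨k', hk'1, hk'2, hkk'⟩ := hΨs _ hkΨ
    have := hinj k k' (by omega) hk'2 hkk'
    omega
  -- the pocket is a closed trail
  have hΨn : Ψ.edges.Nodup := by
    rw [hΨ, SimpleGraph.Walk.edges_cons, List.nodup_cons]
    refine ⟨fun hmem => ?_, hqp.edges_nodup⟩
    obtain ⟨k, hk, hcase⟩ := triple_mem_edges r (hqe _ hmem)
    rcases hcase with ⟨h1, -⟩ | ⟨h1, h2⟩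
    · have := hinj k r.length hk.le le_rfl h1
      omega
    · have e1 := hinj k m hk.le (by omega) h1
      have e2 := hinj (k + 1) r.length hk le_rfl h2
      omega
  -- the jump across the closing edge `{f + d.ccw, f + d.ccw + d}`
  have hjump : walkWinding Ψ (cornerFace (f + d.ccw.vec, d)) ≠
      walkWinding Ψ (cornerFace (f + d.ccw.vec, d) + d.ccw.vec) := by
    refine abab_walkWinding_ne_of_sepEdge_mem hΨn (adj_cornerFace_add (f + d.ccw.vec, d)) ?_
    rw [sepEdge_cornerFace, ← hm, ← hvx, hΨ, SimpleGraph.Walk.edges_cons]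
    exact List.mem_cons.2 (Or.inl Sym2.eq_swap)
  -- the start face is around `f`, the end face around `r_{m-1} = f + 2 d.ccw`
  have hφ₀ : walkWinding Ψ (cornerFace (f + d.ccw.vec, d)) = walkWinding Ψ f := by
    refine triple_walkWinding_face Ψ (hoffA f hf) ?_
    simpa only [add_sub_cancel_right] using triple_cornerFace_back (f + d.ccw.vec) d
  have hΦ₂ : walkWinding Ψ (cornerFace (f + d.ccw.vec, d) + d.ccw.vec) = walkWinding Ψ (r.getVert (m - 1)) := by
    refine triple_walkWinding_face Ψ (hofflt (m - 1) (by omega)) ?_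
    rw [hm1, hm]
    exact triple_cornerFace_end_ahead (f + d.ccw.vec) d
  -- the chain `f ⟶_A a — r_{m'} ⟶_r r_{m-1}` avoids the pocket
  obtain ⟨ω, hω⟩ := hA f hf a ha
  have h1 : walkWinding Ψ f = walkWinding Ψ a :=
    walkWinding_eq_of_walk_closed Ψ ω fun z hz => hoffA z (hω z hz)
  have h2 : walkWinding Ψ a = walkWinding Ψ (r.getVert m') := by
    refine walkWinding_eq_of_walk_closed Ψ (SimpleGraph.Walk.cons hadj SimpleGraph.Walk.nil) ?_
    intro z hz
    rw [SimpleGraph.Walk.support_cons, SimpleGraph.Walk.support_nil, List.mem_cons, List.mem_singleton] at hz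
    rcases hz with rfl | rfl
    · exact hoffA _ ha
    · exact hofflt m' hm'm
  obtain ⟨q', -, hq's, -⟩ := triple_slice hr (show m' ≤ m - 1 by omega)
  have h3 : walkWinding Ψ (r.getVert m') = walkWinding Ψ (r.getVert (m - 1)) :=
    walkWinding_eq_of_walk_closed Ψ q' fun z hz => by
      obtain ⟨k, -, hk, rfl⟩ := hq's z hz
      exact hofflt k (by omega)
  exact hjump (by rw [hφ₀, h1, h2, h3, hΦ₂])

/-! ### The pocket through the near endpoint `u = r_0` -/

/-- **Pocket through `u` (refutation of the wrap through the near endpoint in the presence of a later contact).**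
`r` a lattice path avoiding the `4`-connected set `A`; `f ∈ A`; `r_n = f + d`, `r_0 = f + d + d.ccw` (so the
lattice edge `r_n — r_0` closes the pocket `r[0 .. n]`, `n ≥ 3`), `r_{n+1} = r_n + d`; and an `A`-site `a`
adjacent to a vertex `r_{m'}` with `n < m' ≤ L`.  Impossible: the pocket winds differently about the block face
(around `f`) and the face beyond `r_n` (around `r_{n+1}`), yet `f ⟶_A a — r_{m'} ⟶_r r_{n+1}` avoids the pocket.
[folklore] -/
theorem triple_pocket_u : ∀ (A : Finset (Site 2)) {u v : Site 2} (r : (zdGraph 2).Walk u v) (f a : Site 2) (d : ODir) (n m' : ℕ), r.IsPath → (∀ z ∈ r.support, z ∉ A) → (∀ x ∈ A, ∀ y ∈ A, ∃ w : (zdGraph 2).Walk x y, ∀ z ∈ w.support, z ∈ A) → f ∈ A → a ∈ A → (zdGraph 2).Adj a (r.getVert m') → n < m' → m' ≤ r.length → 3 ≤ n → r.getVert n = f + d.vec → r.getVert 0 = f + d.vec + d.ccw.vec → r.getVert (n + 1) = r.getVert n + d.vec → False := by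
  intro A u v r f a d n m' hr hrA hA hf ha hadj hnm' hm'L hn3 hn h0 hn1
  have hinj : ∀ i j, i ≤ r.length → j ≤ r.length → r.getVert i = r.getVert j → i = j :=
    fun i j hi hj h => hr.getVert_injOn (by simpa using hi) (by simpa using hj) h
  -- the pocket: `r[0 .. n]` closed by the lattice edge `r_n → r_0`
  obtain ⟨q, hqp, hqs, hqe⟩ := triple_slice hr (Nat.zero_le n)
  have hux : r.getVert 0 = r.getVert n + d.ccw.vec := by rw [h0, hn]
  have hclose : (zdGraph 2).Adj (r.getVert n) (r.getVert 0) := by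
    rw [hux]; exact ODir.adj_add_vec _ _
  set Ψ : (zdGraph 2).Walk (r.getVert n) (r.getVert n) := SimpleGraph.Walk.cons hclose q with hΨ
  have hΨs : ∀ z ∈ Ψ.support, ∃ k, k ≤ n ∧ z = r.getVert k := by
    intro z hz
    rw [hΨ, SimpleGraph.Walk.support_cons, List.mem_cons] at hz
    rcases hz with rfl | hz
    · exact ⟨n, le_rfl, rfl⟩
    · obtain ⟨k, -, hk, rfl⟩ := hqs z hz
      exact ⟨k, hk, rfl⟩
  have hoffA : ∀ z ∈ A, z ∉ Ψ.support := fun z hz hzΨ => by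
    obtain ⟨k, -, rfl⟩ := hΨs z hzΨ
    exact hrA _ (r.getVert_mem_support k) hz
  have hoffgt : ∀ k, n < k → k ≤ r.length → r.getVert k ∉ Ψ.support := fun k hk hkL hkΨ => by
    obtain ⟨k', hk'1, hkk'⟩ := hΨs _ hkΨ
    have := hinj k k' hkL (by omega) hkk'
    omega
  -- the pocket is a closed trail
  have hΨn : Ψ.edges.Nodup := by
    rw [hΨ, SimpleGraph.Walk.edges_cons, List.nodup_cons]
    refine ⟨fun hmem => ?_, hqp.edges_nodup⟩
    obtain ⟨k, hk, hcase⟩ := triple_mem_edges r (hqe _ hmem)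
    rcases hcase with ⟨-, h2⟩ | ⟨h1, h2⟩
    · have := hinj (k + 1) 0 hk (by omega) h2
      omega
    · have e1 := hinj k 0 hk.le (by omega) h1
      have e2 := hinj (k + 1) n hk (by omega) h2
      omega
  -- the jump across the closing edge `{f + d, f + d + d.ccw}`
  have hjump : walkWinding Ψ (cornerFace (f + d.vec, d.ccw)) ≠
      walkWinding Ψ (cornerFace (f + d.vec, d.ccw) + d.ccw.ccw.vec) := by
    refine abab_walkWinding_ne_of_sepEdge_mem hΨn (adj_cornerFace_add (f + d.vec, d.ccw)) ?_
    rw [sepEdge_cornerFace, ← hn, ← hux, hΨ, SimpleGraph.Walk.edges_cons]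
    exact List.mem_cons_self
  -- the start face is around `r_{n+1} = f + 2 d`, the end face around `f`
  have hψ₁ : walkWinding Ψ (cornerFace (f + d.vec, d.ccw)) = walkWinding Ψ (r.getVert (n + 1)) := by
    refine triple_walkWinding_face Ψ (hoffgt (n + 1) (by omega) (by omega)) ?_
    have e : f + d.vec - d.ccw.ccw.vec = r.getVert (n + 1) := by
      rw [hn1, hn, ODir.vec_ccw_ccw, sub_neg_eq_add]
    simpa only [e] using triple_cornerFace_back (f + d.vec) d.ccw
  have hψ₀ : walkWinding Ψ (cornerFace (f + d.vec, d.ccw) + d.ccw.ccw.vec) = walkWinding Ψ f := by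
    refine triple_walkWinding_face Ψ (hoffA f hf) ?_
    have e : f + d.vec + d.ccw.ccw.vec = f := by rw [ODir.vec_ccw_ccw, add_neg_cancel_right]
    simpa only [e] using triple_cornerFace_end_ahead (f + d.vec) d.ccw
  -- the chain `f ⟶_A a — r_{m'} ⟶_r r_{n+1}` avoids the pocket
  obtain ⟨ω, hω⟩ := hA f hf a ha
  have h1 : walkWinding Ψ f = walkWinding Ψ a :=
    walkWinding_eq_of_walk_closed Ψ ω fun z hz => hoffA z (hω z hz)
  have h2 : walkWinding Ψ a = walkWinding Ψ (r.getVert m') := by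
    refine walkWinding_eq_of_walk_closed Ψ (SimpleGraph.Walk.cons hadj SimpleGraph.Walk.nil) ?_
    intro z hz
    rw [SimpleGraph.Walk.support_cons, SimpleGraph.Walk.support_nil, List.mem_cons, List.mem_singleton] at hz
    rcases hz with rfl | rfl
    · exact hoffA _ ha
    · exact hoffgt m' hnm' hm'L
  obtain ⟨q', -, hq's, -⟩ := triple_slice hr (show n + 1 ≤ m' by omega)
  have h3 : walkWinding Ψ (r.getVert (n + 1)) = walkWinding Ψ (r.getVert m') :=
    walkWinding_eq_of_walk_closed Ψ q' fun z hz => by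
      obtain ⟨k, hk, hk', rfl⟩ := hq's z hz
      exact hoffgt k (by omega) (by omega)
  exact hjump (by rw [hψ₁, h3, ← h2, ← h1, hψ₀])

end Summit.CriticalPhenomena.SAWScalingLimit.Theorems.FKGToTraversalBound.SlitNecklace

end
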